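/-
Copyright: lit-balaban Phase-2 proof seat p29 (gen 29).  Statement-level skeleton of a published paper; no proof claims beyond what the
kernel checks below.
-/
import Literature.MathematicalPhysics.QuantumFieldTheory.BalabanImbrieJaffe1984to88.BIJ88LocDeriv231FlatTorus
import Literature.MathematicalPhysics.QuantumFieldTheory.BalabanImbrieJaffe1984to88.BIJ88LocHolder230FlatTorus

/-!
# `BalabanImbrieJaffe1984to88.BIJ88LocHolder231FlatTorus` — T. Bałaban, J. Imbrie, A. Jaffe, *Effective action and cluster properties of
the abelian Higgs model*, Commun. Math. Phys. **114** (1988) 257–315 [BalabanImbrieJaffe1988], Sect. 2 p. 263 [PDF 7], the sentence after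
(2.33): *"Bounds analogous to (2.30), (2.31) hold for covariant derivatives and Hölder derivatives of G_{k,loc}(u) of order less than two"* —
**THE HÖLDER MEMBER OF ORDER `θ ≤ 1` OF (2.31) AT EVERY PURE-GAUGE BACKGROUND `u = 1^h` FOR THE PRINTED LOCALIZATION DATA** (the torus cubes
`{□_α}`, the weights `λ_α` of (2.27) and the cut-off `ζ″` of (2.29) of gen 26's `BIJ88LocWeights227Torus`): the gauge-covariant Hölder quotient
`(L^k/|x₁ − x₂|_T)^θ·|u(Γ_{x₁x₂})ψ(x₂) − ψ(x₁)|` of the DIFFERENCE `ψ = G_{k,loc}(1^h)f − G_k(Ω₀,1^h)f` obeys the (2.31)-type bound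
`(L^kε)²·C·[bracket of the radii]·e^{−δ₀ dist(suppt f, {x₁,x₂})/(2L^k)}‖f‖_∞` for every pair of points deep inside `Ω₀`, every `0 ≤ θ ≤ 1` —
the companion of gen 28's (2.30) member `BIJ88LocHolder230FlatTorus.holder230_flat_cwt`.

statement-level skeleton of published theorems with citation tags; proofs where landed; nothing here is a claim about the Yang–Mills mass gap

PDF held: `paper:balaban1988-cmp114-bij-abelian-higgs-effective-action` (journal page = PDF page + 256); p. 263 [PDF 7] re-read this session on
the page render `run/shared/lean/pub/lit-balaban/lit-balaban-p31/renders/original-p007-x2.png`; [6] = [Balaban1983RegularityDecay] p. 573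
(*"Γ_{x,x′} a shortest contour connecting these points"*) re-read from the text layer of `paper:balaban1983-cmp89-regularity-decay`.

CITATION HEADER (lean-in-tree rule).  Part of the lit-balaban TYPED SKELETON (HOME `run/shared/lean/pub/lit-balaban/`), PHASE-2 proof seat
p29 gen 29 (unit `lit-balaban-p29-g29`; TAKING line HOME/STATUS.md 2026-08-23 (second file of the gen, own lineage: the gen-28 HANDOFF
*"NEXT FREE TARGETS: (2.31)-analogue Hölder members"*); free-target protocol G.5-34(d)).  Rows **C2.Eq2.31** / **C2.Claim@263** (owner r18; the
abstract hence-step is p08's `BIJ88HolderDecay230`, unchanged; the value member (2.31) for the data is gen 27's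
`BIJ88LocWeights227Torus.opClose231_flat_cwt`, the covariant-derivative member gen 27's `BIJ88LocDeriv231FlatTorus.deriv231_flat_cwt`).  Kind:
theorems only (no definition, no `Prop`-valued fact; gen 26–28's / p31's declarations used BY NAME).

THE PRINTED TEXT (verbatim, p. 263).  *"|(G_{k,loc}(u)f − G_k(Ω,u)f)(x)| ≦ e^{−cr(e_k)}e^{−c dist(suppt f,x)}‖f‖_∞, (2.31) for dist(x,Ω^c) ≧
O(r(e_k)). [Each G_k(□_α,u) is close to G_k(Ω,u) for the relevant x₁, x₂, therefore the convex combination and G_{k,loc} are close also.] …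
Bounds analogous to (2.30), (2.31) hold for covariant derivatives and Hölder derivatives of G_{k,loc}(u) of order less than two."*

THE MECHANISM (ours, declared — gen 28's mechanism for (2.30) verbatim with the (2.31) inputs).  NEAR PAIRS (`|x₁ − x₂|_T ≤ L^k ≤ R₀`): both
points lie in the no-wrap box at chart depth `≥ R₀`, so their chart coordinates differ by `≤ |x₁ − x₂|_T` coordinatewise (gen 26's
`mem_and_abs_sub_le_of_T_le`) and the coordinate hull lies in `Ω₀` at depth `≥ R₀` within `|x₁ − x₂|_T` of `x₁`; along a staircase in the
hull the transported difference of `ψ = G_{k,loc}f − G_k(Ω₀)f` telescopes bond by bond (gen 28's `norm_sub_le_mul_l1_of_bond_bound`,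
`norm_rot_tgt_sub_rot_src`: `Φ(b₊) − Φ(b₋) = h(b₋)⁻¹ε(D_{1^h}ψ)(b)`, `Φ = h̄ψ`), each bond costing `ε` times gen 27's derivative member of
(2.31) (`D_uψ = D_u(G_{k,loc}f) − D_u(G_k(Ω₀)f)`, `covD_sub`) at the support distance `D − |x₁ − x₂|_T ≥ D − L^k`; the weight
`(L^k/T)^θ ≤ L^k/T` (`θ ≤ 1`) against the `≤ (d+1)T` steps leaves `(d+1)·L^kε`.  FAR PAIRS (`|x₁ − x₂|_T > L^k`): weight `≤ 1`, two value
members of (2.31) (`opClose231_flat_cwt`), `|h| = 1`.  The rates of the two inputs are merged into `δ₀ = min`, which is monotone on the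
three exponentials of the bracket once `R ≥ 1/2` and `R₁ ≥ 1`.

WHAT IS PROVED (theorems only; 0 `sorry`; standard axioms).
* §1 (private) `rpow_le_self_of_one_le`, `covD_sub`.
* §2 **`holder231_flat_cwt`** — THERE EXIST `δ₀, c₀ > 0` depending on `(d, ℓ, a)` only such that for every volume (`P.d = d+1`, `P.L = ℓ+1`),
  every `1 ≤ k ≤ K`, every no-wrap box `Ω₀ = c·L^k + Π_i[0, L^k·M₀_i)` shorter than the torus with torus gap `≥ R`, cube spacing `s ≥ 1`,
  half-width `W ≥ 2s/3 + R₀/2 + R`, radii `1 < R`, `1 ≤ R₁ < R₀`, `L^k ≤ R₀`, every pure gauge `h`, every `0 ≤ θ ≤ 1`, all `x₁, x₂ ∈ Ω₀` at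
  chart depth `≥ R₀`, every `f` with `‖f‖_∞ ≤ F` supported at sup-torus distance `≥ D ≥ 0` from both points:
  `(L^k/|x₁ − x₂|_T)^θ·‖h(x₁)h(x₂)⁻¹ψ(x₂) − ψ(x₁)‖ ≤
   (L^kε)²·c₀·[m(1 + L^k((R₀−R₁)⁻¹ + s⁻¹))e^{−δ₀(2R−1)/L^k} + (1 + L^k(R₀−R₁)⁻¹)e^{−(δ₀/2)(R₁−1)/L^k}]·e^{−(δ₀/2)D/L^k}·F`,
  `m = (⌊(L^k − 1 + R₀)/s⌋ + 3)^{d+1}` — at the printed radii (`R, R₁ ~ r(e_k)L^k`; `s, R₀ − R₁ ≫ L^k`) the bracket is print's `e^{−cr(e_k)}`.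
HONEST SCOPE.  (i) FLAT / PURE-GAUGE BACKGROUNDS ONLY (the non-flat (2.31)-analogues need the closeness of `G_k(□_α,u)` to `G_k(Ω,u)` at
non-flat `u` — fronts (β) of the owner's `C2S14-CLOSURE.md`, r01's `BIJ85NeumannPropagatorRegularClose` at (2.23)-regular `A`).  (ii) ORDER
`θ ≤ 1` ONLY (the quotient of the VALUES of `ψ`); the order `1 + θ` member of (2.31) (Hölder quotient of `D_uψ`) needs [6] (1.9)+(1.12) for
cubes in level-`k` units — not here.  (iii) Hypotheses as gen 28's `holder230_flat_cwt` plus `R₁ ≥ 1` (rate bookkeeping); the bracket is gen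
27's, explicit instead of print's `e^{−cr(e_k)}`; `K_σ` by compactness; constants not optimized; `j = 0`, `1 ≤ k ≤ K`.  (iv)
`set_option maxHeartbeats 400000` on the theorem (elaboration budget only).  Imports: gen 27 `BIJ88LocDeriv231FlatTorus`, gen 28
`BIJ88LocHolder230FlatTorus` (→ gen 26/27, p31, p13).  Literature + Mathlib only.  Unit `lit-balaban-p29` (literature-prover-lit-balaban-p29-g29-0),
2026-08-23.  NOT summit progress.
-/

open scoped BigOperators Matrix ComplexConjugate
open Finset Matrix Set

namespace Literature.MathematicalPhysics.QuantumFieldTheory.BalabanImbrieJaffe1984to88.BIJ88LocHolder231FlatTorus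

open Literature.MathematicalPhysics.QuantumFieldTheory.Balaban1983to89
open BIJ88Sect3Statements (U1 toC cfg covD toC_mul toC_one norm_toC)
open BIJ85BlockAveragesTorus BIJ85BlockAveragesTorusK
open BIJ88NeumannPropagator227Torus (gBox)
open BIJ88DeltaLoc234Torus (gLocT)
open BIJ88NeumannPropagatorFlatDecayCube
open BIJ88Cutoffs21 (cutoff)
open BIJ88LocWeights227Torus
open BIJ88LocDeriv231FlatTorus (deriv231_flat_cwt)
open BIJ88LocHolder230FlatTorus (norm_sub_le_mul_l1_of_bond_bound norm_rot_tgt_sub_rot_src norm_transport_sub)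
open B4Reflection242 (boxDom mem_boxDom)
open B4ContourShift (supNorm abs_le_supNorm supNorm_nonneg exists_supNorm_eq)
open GaugeField (gaugeAct)

noncomputable section

variable {d : ℕ} {P : Params}

/-! ## §1 Kernel lemmas -/

/-- kernel: for `1 ≤ t` and `θ ≤ 1`, `t^θ ≤ t`. [folklore] -/
private theorem rpow_le_self_of_one_le {t θ : ℝ} (ht : 1 ≤ t) (hθ : θ ≤ 1) : t ^ θ ≤ t := by
  have h := Real.rpow_le_rpow_of_exponent_le ht hθ
  rwa [Real.rpow_one] at h

/-- kernel: the covariant derivative is additive in the function: `D_u(φ − ψ) = D_uφ − D_uψ`. [cite: BalabanImbrieJaffe1988, (3.3) p.265] -/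
private theorem covD_sub {j : ℕ} (c' : ℝ) (u : PBond P j → ℂ) (φ ψ : Balaban1983to89.Site P j → ℂ) (b : PBond P j) :
    covD c' u (φ - ψ) b = covD c' u φ b - covD c' u ψ b := by
  simp only [covD, Pi.sub_apply]; ring

/-! ## §2 The Hölder member of order `θ ≤ 1` of (2.31) at flat backgrounds FOR THE PRINTED DATA -/

section Holder

set_option maxHeartbeats 400000 in
/-- **THE HÖLDER MEMBER OF ORDER `θ ≤ 1` OF (2.31) AT EVERY PURE-GAUGE BACKGROUND `u = 1^h`, FOR THE PRINTED LOCALIZATION DATA** (p. 263: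
*"|(G_{k,loc}(u)f − G_k(Ω,u)f)(x)| ≦ e^{−cr(e_k)}e^{−c dist(suppt f,x)}‖f‖_∞, (2.31) for dist(x,Ω^c) ≧ O(r(e_k)) … Bounds analogous to (2.30),
(2.31) hold for covariant derivatives and Hölder derivatives of G_{k,loc}(u) of order less than two"*, the (2.31)-analogue for the Hölder
quotients of the values).  THERE EXIST `δ₀, c₀ > 0` depending on `(d, ℓ, a)` only such that for every volume (`P.d = d+1`, `P.L = ℓ+1`), every
`1 ≤ k ≤ K`, every no-wrap box `Ω₀ = c·L^k + Π_i[0, L^k·M₀_i)` shorter than the torus leaving a torus gap `≥ R`, cube spacing `s ≥ 1`,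
half-width `W ≥ 2s/3 + R₀/2 + R`, radii `1 < R`, `1 ≤ R₁ < R₀` with `L^k ≤ R₀`, every pure gauge `h`, EVERY exponent `0 ≤ θ ≤ 1`, all fine
sites `x₁, x₂ ∈ Ω₀` at chart depth `≥ R₀`, and every source `f` with `‖f‖_∞ ≤ F` supported at sup-torus distance `≥ D ≥ 0` from `x₁` and
from `x₂`: with `ψ = G_{k,loc}(1^h)f − G_k(Ω₀,1^h)f`,
`(L^k/|x₁ − x₂|_T)^θ·‖h(x₁)h(x₂)⁻¹ψ(x₂) − ψ(x₁)‖ ≤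
 (L^kε)²·c₀·[m(1 + L^k((R₀−R₁)⁻¹ + s⁻¹))e^{−δ₀(2R−1)/L^k} + (1 + L^k(R₀−R₁)⁻¹)e^{−(δ₀/2)(R₁−1)/L^k}]·e^{−(δ₀/2)D/L^k}·F`,
`m = (⌊(L^k − 1 + R₀)/s⌋ + 3)^{d+1}`, `h(x₁)h(x₂)⁻¹` the pure-gauge transport along any contour — gen 27's derivative member of (2.31)
(`deriv231_flat_cwt`) telescoped along a staircase inside `Ω₀` for near pairs (`|x₁ − x₂|_T ≤ L^k`; gen 28's `norm_sub_le_mul_l1_of_bond_bound`,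
`(L^k/T)^θ·(d+1)T·ε ≤ (d+1)L^kε`), two (2.31) value members (`opClose231_flat_cwt`) for far pairs; at the printed radii (`R, R₁ ~ r(e_k)L^k`,
`s, R₀ − R₁ ≫ L^k`) the bracket is `e^{−cr(e_k)}`. [cite: BalabanImbrieJaffe1988, (2.31) p.263] -/
theorem holder231_flat_cwt (d ℓ : ℕ) (hℓ : 1 ≤ ℓ) {a : ℝ} (ha : 0 < a) :
    ∃ δ₀ c₀ : ℝ, 0 < δ₀ ∧ 0 < c₀ ∧ ∀ (P : Params) (hPd : P.d = d + 1), P.L = ℓ + 1 →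
      ∀ k : ℕ, 1 ≤ k → k ≤ P.K → ∀ (c M0 : Fin (d + 1) → ℕ), (∀ i, 1 ≤ M0 i) →
        (∀ i, c i * P.L ^ k + P.L ^ k * M0 i ≤ P.sitesPerDir 0) → (∀ i, P.L ^ k * M0 i < P.sitesPerDir 0) →
      ∀ (s W : ℕ), 1 ≤ s → ∀ (R R₀ R₁ : ℝ), 1 < R → 1 ≤ R₁ → R₁ < R₀ → 2 * (s : ℝ) / 3 + R₀ / 2 + R ≤ W →
        (∀ i, ((P.L ^ k * M0 i : ℕ) : ℝ) + R ≤ P.sitesPerDir 0) → (P.L : ℝ) ^ k ≤ R₀ →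
      ∀ (h : GaugeTransf P 0 U1) (θ : ℝ), 0 ≤ θ → θ ≤ 1 →
      ∀ (x₁ x₂ : Balaban1983to89.Site P 0),
        x₁ ∈ (cubeT hPd (P.L ^ k) c fun i => P.L ^ k * M0 i) →
        (∀ i, R₀ ≤ (boxCoord hPd (P.L ^ k) c x₁ i : ℝ) ∧ (boxCoord hPd (P.L ^ k) c x₁ i : ℝ) + R₀ ≤ (P.L ^ k * M0 i : ℕ) - 1) →
        x₂ ∈ (cubeT hPd (P.L ^ k) c fun i => P.L ^ k * M0 i) →
        (∀ i, R₀ ≤ (boxCoord hPd (P.L ^ k) c x₂ i : ℝ) ∧ (boxCoord hPd (P.L ^ k) c x₂ i : ℝ) + R₀ ≤ (P.L ^ k * M0 i : ℕ) - 1) →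
      ∀ (f : Balaban1983to89.Site P 0 → ℂ) (F D : ℝ), (∀ y, ‖f y‖ ≤ F) → 0 ≤ D →
        (∀ y, f y ≠ 0 → D ≤ B5Ineq137Torus.T P 0 x₁ y) → (∀ y, f y ≠ 0 → D ≤ B5Ineq137Torus.T P 0 x₂ y) →
        ((P.L : ℝ) ^ k / B5Ineq137Torus.T P 0 x₁ x₂) ^ θ *
          ‖toC (h x₁) * (toC (h x₂))⁻¹ *
              ((gLocT (B1RG242Torus.α P a k * (P.L : ℝ) ^ (k * P.d)) P.eps⁻¹ (gaugeAct h (1 : GaugeField P 0 U1)) k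
                  (cubeFam hPd (P.L ^ k) c M0 s W) (lamFam hPd (P.L ^ k) c M0 s) (cutoff R₁ R₀ (B5Ineq137Torus.T P 0)) *ᵥ f) x₂ -
                (gBox (B1RG242Torus.α P a k * (P.L : ℝ) ^ (k * P.d)) P.eps⁻¹ (gaugeAct h (1 : GaugeField P 0 U1)) k
                  (cubeT hPd (P.L ^ k) c fun i => P.L ^ k * M0 i) *ᵥ f) x₂) -
            ((gLocT (B1RG242Torus.α P a k * (P.L : ℝ) ^ (k * P.d)) P.eps⁻¹ (gaugeAct h (1 : GaugeField P 0 U1)) k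
                  (cubeFam hPd (P.L ^ k) c M0 s W) (lamFam hPd (P.L ^ k) c M0 s) (cutoff R₁ R₀ (B5Ineq137Torus.T P 0)) *ᵥ f) x₁ -
                (gBox (B1RG242Torus.α P a k * (P.L : ℝ) ^ (k * P.d)) P.eps⁻¹ (gaugeAct h (1 : GaugeField P 0 U1)) k
                  (cubeT hPd (P.L ^ k) c fun i => P.L ^ k * M0 i) *ᵥ f) x₁)‖ ≤
          P.spacing k ^ 2 * (c₀ * ((⌊(((P.L : ℝ) ^ k) - 1 + R₀) / s⌋₊ + 3) ^ (d + 1) * (1 + (P.L : ℝ) ^ k * ((R₀ - R₁)⁻¹ + (s : ℝ)⁻¹)) *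
              Real.exp (-(δ₀ * (((P.L : ℝ) ^ k)⁻¹ * (2 * R - 1)))) +
            (1 + (P.L : ℝ) ^ k * (R₀ - R₁)⁻¹) * Real.exp (-(δ₀ / 2 * (((P.L : ℝ) ^ k)⁻¹ * (R₁ - 1))))) *
            Real.exp (-(δ₀ / 2 * (((P.L : ℝ) ^ k)⁻¹ * D))) * F) := by
  obtain ⟨δ₁, c₁, hδ₁, hc₁, H1⟩ := deriv231_flat_cwt d ℓ hℓ ha
  obtain ⟨δ₂, c₂, hδ₂, hc₂, H2⟩ := opClose231_flat_cwt d ℓ hℓ ha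
  refine ⟨min δ₁ δ₂, max (((d : ℝ) + 1) * Real.exp (δ₁ / 2) * c₁) (2 * c₂), lt_min hδ₁ hδ₂, lt_max_of_lt_right (by positivity), ?_⟩
  intro P hPd hPL k hk1 hkK c M0 hM0 hfit0 hN0 s W hs R R₀ R₁ hR hR₁1 hR10 hW hgapR hLR₀ h θ hθ0 hθ1 x₁ x₂ hx₁ hdeep₁ hx₂ hdeep₂
    f F D hF hD hsupp₁ hsupp₂
  have hR₁ : 0 ≤ R₁ := zero_le_one.trans hR₁1
  set δ := min δ₁ δ₂ with hδdef
  set C := max (((d : ℝ) + 1) * Real.exp (δ₁ / 2) * c₁) (2 * c₂) with hCdef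
  have hδ1 : δ ≤ δ₁ := min_le_left _ _
  have hδ2 : δ ≤ δ₂ := min_le_right _ _
  have hδ0 : 0 < δ := lt_min hδ₁ hδ₂
  have hC1 : ((d : ℝ) + 1) * Real.exp (δ₁ / 2) * c₁ ≤ C := le_max_left _ _
  have hC2 : 2 * c₂ ≤ C := le_max_right _ _
  have hC0 : 0 ≤ C := le_trans (by positivity) hC2
  have hLpos : (0 : ℝ) < P.L := P.cast_L_pos
  have hLk : (0 : ℝ) < (P.L : ℝ) ^ k := pow_pos hLpos _
  have hLkinv : 0 < ((P.L : ℝ) ^ k)⁻¹ := inv_pos.mpr hLk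
  have hF0 : 0 ≤ F := (norm_nonneg _).trans (hF x₁)
  have hsp0 : 0 < P.spacing k := P.spacing_pos k
  have heps : 0 < P.eps := P.eps_pos
  have hsr : (0 : ℝ) < s := by exact_mod_cast hs
  have hgap' : 0 < R₀ - R₁ := sub_pos.2 hR10
  have hR0 : 0 ≤ R := zero_le_one.trans hR.le
  have hT0 : 0 ≤ B5Ineq137Torus.T P 0 x₁ x₂ := B5Ineq137Torus.T_nonneg P 0 x₁ x₂
  -- abbreviations
  set A : ℝ := B1RG242Torus.α P a k * (P.L : ℝ) ^ (k * P.d) with hAdef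
  set U : GaugeField P 0 U1 := gaugeAct h (1 : GaugeField P 0 U1) with hUdef
  set ζ := cutoff R₁ R₀ (B5Ineq137Torus.T P 0) with hζdef
  set Ω₀ : Finset (Balaban1983to89.Site P 0) := cubeT hPd (P.L ^ k) c fun i => P.L ^ k * M0 i with hΩ₀def
  set ψL : Balaban1983to89.Site P 0 → ℂ :=
    gLocT A P.eps⁻¹ U k (cubeFam hPd (P.L ^ k) c M0 s W) (lamFam hPd (P.L ^ k) c M0 s) ζ *ᵥ f with hψLdef
  set ψΩ : Balaban1983to89.Site P 0 → ℂ := gBox A P.eps⁻¹ U k Ω₀ *ᵥ f with hψΩdef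
  set ψ : Balaban1983to89.Site P 0 → ℂ := ψL - ψΩ with hψdef
  have hψ : ∀ x, ψL x - ψΩ x = ψ x := fun x => rfl
  set T12 : ℝ := B5Ineq137Torus.T P 0 x₁ x₂ with hT12def
  set m : ℝ := ((⌊(((P.L : ℝ) ^ k) - 1 + R₀) / s⌋₊ : ℝ) + 3) ^ (d + 1) with hmdef
  have hm0 : 0 ≤ m := by rw [hmdef]; positivity
  have hm1 : 1 ≤ m := by
    rw [hmdef]
    have h0 : (0 : ℝ) ≤ (⌊(((P.L : ℝ) ^ k) - 1 + R₀) / s⌋₊ : ℝ) := Nat.cast_nonneg _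
    have : (1 : ℝ) ≤ (⌊(((P.L : ℝ) ^ k) - 1 + R₀) / s⌋₊ : ℝ) + 3 := by linarith
    exact one_le_pow₀ this
  set br : ℝ := 1 + (P.L : ℝ) ^ k * ((R₀ - R₁)⁻¹ + (s : ℝ)⁻¹) with hbrdef
  have hbr1 : 1 ≤ br := by rw [hbrdef]; exact le_add_of_nonneg_right (by positivity)
  have hbr0 : 0 ≤ br := zero_le_one.trans hbr1
  set br₁ : ℝ := 1 + (P.L : ℝ) ^ k * (R₀ - R₁)⁻¹ with hbr₁def
  have hbr₁1 : 1 ≤ br₁ := by rw [hbr₁def]; exact le_add_of_nonneg_right (by positivity)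
  have hbr₁0 : 0 ≤ br₁ := zero_le_one.trans hbr₁1
  set ER : ℝ := Real.exp (-(δ * (((P.L : ℝ) ^ k)⁻¹ * (2 * R - 1)))) with hERdef
  set ER₁ : ℝ := Real.exp (-(δ / 2 * (((P.L : ℝ) ^ k)⁻¹ * (R₁ - 1)))) with hER₁def
  set Ex : ℝ := Real.exp (-(δ / 2 * (((P.L : ℝ) ^ k)⁻¹ * D))) with hEdef
  have hER0 : 0 < ER := Real.exp_pos _
  have hER₁0 : 0 < ER₁ := Real.exp_pos _
  have hE0 : 0 < Ex := Real.exp_pos _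
  set Br : ℝ := m * br * ER + br₁ * ER₁ with hBrdef
  have hBr0 : 0 ≤ Br := by positivity
  have hεD : 0 ≤ ((P.L : ℝ) ^ k)⁻¹ * D := mul_nonneg hLkinv.le hD
  -- the rate bookkeeping: every printed exponential at rate `δ₁` or `δ₂` is dominated by the one at rate `δ`
  have hER_1 : Real.exp (-(δ₁ * (((P.L : ℝ) ^ k)⁻¹ * (2 * R - 1)))) ≤ ER := by
    refine Real.exp_le_exp.2 (neg_le_neg (mul_le_mul_of_nonneg_right hδ1 (mul_nonneg hLkinv.le (by linarith))))
  have hER_2 : Real.exp (-(δ₂ * (((P.L : ℝ) ^ k)⁻¹ * (2 * R)))) ≤ ER := by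
    refine Real.exp_le_exp.2 (neg_le_neg ?_)
    calc δ * (((P.L : ℝ) ^ k)⁻¹ * (2 * R - 1)) ≤ δ * (((P.L : ℝ) ^ k)⁻¹ * (2 * R)) :=
          mul_le_mul_of_nonneg_left (mul_le_mul_of_nonneg_left (by linarith) hLkinv.le) hδ0.le
      _ ≤ δ₂ * (((P.L : ℝ) ^ k)⁻¹ * (2 * R)) := mul_le_mul_of_nonneg_right hδ2 (mul_nonneg hLkinv.le (by linarith))
  have hER₁_1 : Real.exp (-(δ₁ / 2 * (((P.L : ℝ) ^ k)⁻¹ * (R₁ - 1)))) ≤ ER₁ :=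
    Real.exp_le_exp.2 (neg_le_neg (mul_le_mul_of_nonneg_right (by linarith) (mul_nonneg hLkinv.le (by linarith))))
  have hER₁_2 : Real.exp (-(δ₂ / 2 * (((P.L : ℝ) ^ k)⁻¹ * R₁))) ≤ ER₁ := by
    refine Real.exp_le_exp.2 (neg_le_neg ?_)
    calc δ / 2 * (((P.L : ℝ) ^ k)⁻¹ * (R₁ - 1)) ≤ δ / 2 * (((P.L : ℝ) ^ k)⁻¹ * R₁) :=
          mul_le_mul_of_nonneg_left (mul_le_mul_of_nonneg_left (by linarith) hLkinv.le) (by positivity)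
      _ ≤ δ₂ / 2 * (((P.L : ℝ) ^ k)⁻¹ * R₁) := mul_le_mul_of_nonneg_right (by linarith) (mul_nonneg hLkinv.le hR₁)
  have hE2 : Real.exp (-(δ₂ / 2 * (((P.L : ℝ) ^ k)⁻¹ * D))) ≤ Ex :=
    Real.exp_le_exp.2 (neg_le_neg (mul_le_mul_of_nonneg_right (by linarith) hεD))
  -- the weight
  set w : ℝ := ((P.L : ℝ) ^ k / T12) ^ θ with hwdef
  have hw0 : 0 ≤ w := Real.rpow_nonneg (div_nonneg hLk.le hT0) θ
  -- the Φ-form of the transported difference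
  show w * ‖toC (h x₁) * (toC (h x₂))⁻¹ * (ψL x₂ - ψΩ x₂) - (ψL x₁ - ψΩ x₁)‖ ≤ _
  rw [hψ, hψ, norm_transport_sub]
  -- the target, factorised
  have hRHS : P.spacing k ^ 2 * (C * Br * Ex * F) =
      P.spacing k ^ 2 * (C * ((⌊(((P.L : ℝ) ^ k) - 1 + R₀) / s⌋₊ + 3) ^ (d + 1) * (1 + (P.L : ℝ) ^ k * ((R₀ - R₁)⁻¹ + (s : ℝ)⁻¹)) *
          Real.exp (-(δ * (((P.L : ℝ) ^ k)⁻¹ * (2 * R - 1)))) +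
        (1 + (P.L : ℝ) ^ k * (R₀ - R₁)⁻¹) * Real.exp (-(δ / 2 * (((P.L : ℝ) ^ k)⁻¹ * (R₁ - 1))))) *
        Real.exp (-(δ / 2 * (((P.L : ℝ) ^ k)⁻¹ * D))) * F) := by
    rw [hBrdef, hmdef, hbrdef, hbr₁def, hERdef, hER₁def, hEdef]
  rw [← hRHS]
  by_cases hnear : T12 ≤ (P.L : ℝ) ^ k
  · /- NEAR PAIRS: telescoping along a staircase in the chart -/
    obtain ⟨hz₁, hxz₁⟩ := cubePt_boxCoord hPd hfit0 hx₁
    obtain ⟨hz₂, hxz₂⟩ := cubePt_boxCoord hPd hfit0 hx₂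
    set z₁ := boxCoord hPd (P.L ^ k) c x₁ with hz₁def
    set z₂ := boxCoord hPd (P.L ^ k) c x₂ with hz₂def
    have hdeepT : ∀ i, T12 ≤ (z₁ i : ℝ) ∧ (z₁ i : ℝ) + T12 ≤ (P.L ^ k * M0 i : ℕ) - 1 := fun i => by
      have h1 := hdeep₁ i
      constructor <;> linarith [h1.1, h1.2]
    have hclose : ∀ i, ((|z₁ i - z₂ i| : ℤ) : ℝ) ≤ T12 := (mem_and_abs_sub_le_of_T_le hPd hfit0 hdeepT le_rfl).2
    set lo : Fin (d + 1) → ℤ := fun j => min (z₁ j) (z₂ j) with hlodef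
    set hi : Fin (d + 1) → ℤ := fun j => max (z₁ j) (z₂ j) with hhidef
    have hz₁box : ∀ j, lo j ≤ z₁ j ∧ z₁ j ≤ hi j := fun j => ⟨min_le_left _ _, le_max_left _ _⟩
    have hz₂box : ∀ j, lo j ≤ z₂ j ∧ z₂ j ≤ hi j := fun j => ⟨min_le_right _ _, le_max_right _ _⟩
    have hullDom : ∀ z : Fin (d + 1) → ℤ, (∀ j, lo j ≤ z j ∧ z j ≤ hi j) → z ∈ boxDom (fun i => P.L ^ k * M0 i) := by
      intro z hz
      rw [mem_boxDom]
      intro i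
      have h1 := (mem_boxDom.1 hz₁) i; have h2 := (mem_boxDom.1 hz₂) i; have h3 := hz i
      simp only [hlodef, hhidef] at h3
      constructor <;> omega
    have hullDeep : ∀ z : Fin (d + 1) → ℤ, (∀ j, lo j ≤ z j ∧ z j ≤ hi j) →
        ∀ i, R₀ ≤ (boxCoord hPd (P.L ^ k) c (cubePt hPd (P.L ^ k) c z) i : ℝ) ∧
          (boxCoord hPd (P.L ^ k) c (cubePt hPd (P.L ^ k) c z) i : ℝ) + R₀ ≤ (P.L ^ k * M0 i : ℕ) - 1 := by
      intro z hz i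
      rw [boxCoord_cubePt hPd hfit0 (hullDom z hz)]
      have h1 := hdeep₁ i; have h2 := hdeep₂ i; have h3 := hz i
      simp only [hlodef, hhidef] at h3
      rcases le_total (z₁ i) (z₂ i) with h12 | h12
      · rw [min_eq_left h12, max_eq_right h12] at h3
        have h4 : (z₁ i : ℝ) ≤ z i := by exact_mod_cast h3.1
        have h5 : (z i : ℝ) ≤ z₂ i := by exact_mod_cast h3.2
        exact ⟨h1.1.trans h4, by linarith [h2.2]⟩
      · rw [min_eq_right h12, max_eq_left h12] at h3
        have h4 : (z₂ i : ℝ) ≤ z i := by exact_mod_cast h3.1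
        have h5 : (z i : ℝ) ≤ z₁ i := by exact_mod_cast h3.2
        exact ⟨h2.1.trans h4, by linarith [h1.2]⟩
    have hullClose : ∀ z : Fin (d + 1) → ℤ, (∀ j, lo j ≤ z j ∧ z j ≤ hi j) → supNorm (z₁ - z) ≤ T12 := by
      intro z hz
      obtain ⟨i, hi'⟩ := exists_supNorm_eq (z₁ - z)
      rw [hi', Pi.sub_apply]
      refine le_trans ?_ (hclose i)
      have h3 := hz i
      simp only [hlodef, hhidef] at h3
      have key : |z₁ i - z i| ≤ |z₁ i - z₂ i| := by
        rw [abs_le]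
        rcases le_total (z₁ i) (z₂ i) with h12 | h12
        · rw [min_eq_left h12, max_eq_right h12] at h3
          rw [abs_of_nonpos (by omega : z₁ i - z₂ i ≤ 0)]
          constructor <;> omega
        · rw [min_eq_right h12, max_eq_left h12] at h3
          rw [abs_of_nonneg (by omega : 0 ≤ z₁ i - z₂ i)]
          constructor <;> omega
      exact_mod_cast key
    -- the rotated function read in the chart
    set Ψ : (Fin (d + 1) → ℤ) → ℂ := fun z => (toC (h (cubePt hPd (P.L ^ k) c z)))⁻¹ * ψ (cubePt hPd (P.L ^ k) c z) with hΨdef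
    -- the shortened support distance along the hull
    set D' : ℝ := max (D - T12) 0 with hD'def
    have hD'0 : 0 ≤ D' := le_max_right _ _
    have hD'supp : ∀ z : Fin (d + 1) → ℤ, (∀ j, lo j ≤ z j ∧ z j ≤ hi j) →
        ∀ y, f y ≠ 0 → D' ≤ B5Ineq137Torus.T P 0 (cubePt hPd (P.L ^ k) c z) y := by
      intro z hz y hy
      refine max_le ?_ (B5Ineq137Torus.T_nonneg P 0 _ y)
      have h1 := hsupp₁ y hy
      have h2 := B5Ineq137Torus.T_triangle P 0 x₁ (cubePt hPd (P.L ^ k) c z) y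
      have h3 : B5Ineq137Torus.T P 0 x₁ (cubePt hPd (P.L ^ k) c z) ≤ T12 := by
        have h4 := T_cubePt_le hPd hfit0 hz₁ (hullDom z hz)
        rw [hxz₁] at h4
        exact h4.trans (hullClose z hz)
      linarith
    -- the per-bond bound from gen 27's derivative member of (2.31)
    set B₁ : ℝ := P.spacing k * (c₁ * ((⌊(((P.L : ℝ) ^ k) - 1 + R₀) / s⌋₊ + 3) ^ (d + 1) * (1 + (P.L : ℝ) ^ k * ((R₀ - R₁)⁻¹ + (s : ℝ)⁻¹)) *
        Real.exp (-(δ₁ * (((P.L : ℝ) ^ k)⁻¹ * (2 * R - 1)))) +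
      (1 + (P.L : ℝ) ^ k * (R₀ - R₁)⁻¹) * Real.exp (-(δ₁ / 2 * (((P.L : ℝ) ^ k)⁻¹ * (R₁ - 1))))) *
      Real.exp (-(δ₁ / 2 * (((P.L : ℝ) ^ k)⁻¹ * D'))) * F) with hB₁def
    have hB₁0 : 0 ≤ B₁ := by rw [hB₁def]; positivity
    have hbond : ∀ (z : Fin (d + 1) → ℤ) (i : Fin (d + 1)), (∀ j, lo j ≤ z j ∧ z j ≤ hi j) → z i + 1 ≤ hi i →
        ‖Ψ (z + Pi.single i 1) - Ψ z‖ ≤ P.eps * B₁ := by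
      intro z i hz hzi
      have hz' : ∀ j, lo j ≤ (z + Pi.single i 1 : Fin (d + 1) → ℤ) j ∧ (z + Pi.single i 1 : Fin (d + 1) → ℤ) j ≤ hi j := by
        intro j
        by_cases hji : j = i
        · subst hji; rw [Pi.add_apply, Pi.single_eq_same]; have := hz j; constructor <;> omega
        · rw [Pi.add_apply, Pi.single_eq_of_ne hji, add_zero]; exact hz j
      set x : Balaban1983to89.Site P 0 := cubePt hPd (P.L ^ k) c z with hxdef
      set μ : Fin P.d := Fin.cast hPd.symm i with hμdef
      have hxe : x.shift μ = cubePt hPd (P.L ^ k) c (z + Pi.single i 1) := by rw [cubePt_add_single]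
      have hxmem : x ∈ (cubeT hPd (P.L ^ k) c fun i => P.L ^ k * M0 i) := cubePt_mem_cubeT hPd (hullDom z hz)
      have hxemem : x.shift μ ∈ (cubeT hPd (P.L ^ k) c fun i => P.L ^ k * M0 i) := by
        rw [hxe]; exact cubePt_mem_cubeT hPd (hullDom _ hz')
      have hxdeep := hullDeep z hz
      have hxedeep : ∀ i', R₀ ≤ (boxCoord hPd (P.L ^ k) c (x.shift μ) i' : ℝ) ∧
          (boxCoord hPd (P.L ^ k) c (x.shift μ) i' : ℝ) + R₀ ≤ (P.L ^ k * M0 i' : ℕ) - 1 := by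
        rw [hxe]; exact hullDeep _ hz'
      have hderiv := H1 P hPd hPL k hk1 hkK c M0 hM0 hfit0 hN0 s W hs R R₀ R₁ hR hR₁ hR10 hW hgapR h x μ hxmem hxdeep hxemem hxedeep
        f F D' hF hD'0 (hD'supp z hz)
      rw [← covD_sub] at hderiv
      have hsrc : (⟨x, μ⟩ : PBond P 0).src = x := rfl
      have htgt : (⟨x, μ⟩ : PBond P 0).tgt = cubePt hPd (P.L ^ k) c (z + Pi.single i 1) := hxe
      have hΨ : Ψ (z + Pi.single i 1) - Ψ z =
          (toC (h (⟨x, μ⟩ : PBond P 0).tgt))⁻¹ * ψ (⟨x, μ⟩ : PBond P 0).tgt - (toC (h (⟨x, μ⟩ : PBond P 0).src))⁻¹ * ψ (⟨x, μ⟩ : PBond P 0).src := by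
        rw [hsrc, htgt]
      rw [hΨ, norm_rot_tgt_sub_rot_src h (inv_ne_zero heps.ne') ψ ⟨x, μ⟩, abs_inv, abs_of_pos heps, inv_inv]
      exact mul_le_mul_of_nonneg_left hderiv heps.le
    -- telescoping
    have htel := norm_sub_le_mul_l1_of_bond_bound lo hi Ψ hbond hz₁box hz₂box
    have hl1 : ∑ j, ((|z₂ j - z₁ j| : ℤ) : ℝ) ≤ ((d : ℝ) + 1) * T12 := by
      calc ∑ j, ((|z₂ j - z₁ j| : ℤ) : ℝ) ≤ ∑ _j : Fin (d + 1), T12 :=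
            Finset.sum_le_sum fun j _ => by rw [abs_sub_comm]; exact hclose j
        _ = ((d : ℝ) + 1) * T12 := by rw [Finset.sum_const, Finset.card_univ, Fintype.card_fin, nsmul_eq_mul]; push_cast; ring
    have hΨ₁ : Ψ z₁ = (toC (h x₁))⁻¹ * ψ x₁ := by simp only [hΨdef]; rw [hxz₁]
    have hΨ₂ : Ψ z₂ = (toC (h x₂))⁻¹ * ψ x₂ := by simp only [hΨdef]; rw [hxz₂]
    have hdiff : ‖(toC (h x₂))⁻¹ * ψ x₂ - (toC (h x₁))⁻¹ * ψ x₁‖ ≤ P.eps * B₁ * (((d : ℝ) + 1) * T12) := by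
      rw [← hΨ₁, ← hΨ₂]
      exact htel.trans (mul_le_mul_of_nonneg_left hl1 (by positivity))
    -- the exponent: `D' ≥ D − T12 ≥ D − L^k`
    have hexpD' : Real.exp (-(δ₁ / 2 * (((P.L : ℝ) ^ k)⁻¹ * D'))) ≤ Real.exp (δ₁ / 2) * Ex := by
      have h1 : D - T12 ≤ D' := le_max_left _ _
      have h2 : ((P.L : ℝ) ^ k)⁻¹ * T12 ≤ 1 := by
        rw [inv_mul_le_iff₀ hLk, mul_one]; exact hnear
      have h3 : -(δ₁ / 2 * (((P.L : ℝ) ^ k)⁻¹ * D')) ≤ δ₁ / 2 + -(δ / 2 * (((P.L : ℝ) ^ k)⁻¹ * D)) := by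
        have h4 : δ₁ / 2 * (((P.L : ℝ) ^ k)⁻¹ * (D - T12)) ≤ δ₁ / 2 * (((P.L : ℝ) ^ k)⁻¹ * D') :=
          mul_le_mul_of_nonneg_left (mul_le_mul_of_nonneg_left h1 hLkinv.le) (by positivity)
        have h5 : δ / 2 * (((P.L : ℝ) ^ k)⁻¹ * D) ≤ δ₁ / 2 * (((P.L : ℝ) ^ k)⁻¹ * D) := mul_le_mul_of_nonneg_right (by linarith) hεD
        have h6 : δ₁ / 2 * (((P.L : ℝ) ^ k)⁻¹ * T12) ≤ δ₁ / 2 * 1 := mul_le_mul_of_nonneg_left h2 (by positivity)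
        have h7 : δ₁ / 2 * (((P.L : ℝ) ^ k)⁻¹ * (D - T12)) =
            δ₁ / 2 * (((P.L : ℝ) ^ k)⁻¹ * D) - δ₁ / 2 * (((P.L : ℝ) ^ k)⁻¹ * T12) := by ring
        linarith
      calc Real.exp (-(δ₁ / 2 * (((P.L : ℝ) ^ k)⁻¹ * D'))) ≤ Real.exp (δ₁ / 2 + -(δ / 2 * (((P.L : ℝ) ^ k)⁻¹ * D))) :=
            Real.exp_le_exp.2 h3
        _ = Real.exp (δ₁ / 2) * Ex := by rw [Real.exp_add]
    have hB₁le : B₁ ≤ P.spacing k * (Real.exp (δ₁ / 2) * c₁ * Br * Ex * F) := by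
      rw [hB₁def, ← hmdef, ← hbrdef, ← hbr₁def]
      refine mul_le_mul_of_nonneg_left ?_ hsp0.le
      have hbr_le : m * br * Real.exp (-(δ₁ * (((P.L : ℝ) ^ k)⁻¹ * (2 * R - 1)))) +
          br₁ * Real.exp (-(δ₁ / 2 * (((P.L : ℝ) ^ k)⁻¹ * (R₁ - 1)))) ≤ Br :=
        add_le_add (mul_le_mul_of_nonneg_left hER_1 (by positivity)) (mul_le_mul_of_nonneg_left hER₁_1 hbr₁0)
      calc c₁ * (m * br * Real.exp (-(δ₁ * (((P.L : ℝ) ^ k)⁻¹ * (2 * R - 1)))) +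
            br₁ * Real.exp (-(δ₁ / 2 * (((P.L : ℝ) ^ k)⁻¹ * (R₁ - 1))))) * Real.exp (-(δ₁ / 2 * (((P.L : ℝ) ^ k)⁻¹ * D'))) * F
          ≤ c₁ * Br * (Real.exp (δ₁ / 2) * Ex) * F :=
            mul_le_mul_of_nonneg_right (mul_le_mul (mul_le_mul_of_nonneg_left hbr_le hc₁.le) hexpD' (Real.exp_pos _).le
              (by positivity)) hF0
        _ = Real.exp (δ₁ / 2) * c₁ * Br * Ex * F := by ring
    -- the weight against the number of steps: `w·(d+1)T12·ε ≤ (d+1)·L^k·ε`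
    have hwT : w * (P.eps * B₁ * (((d : ℝ) + 1) * T12)) ≤ ((d : ℝ) + 1) * (P.eps * (P.L : ℝ) ^ k) * B₁ := by
      rcases hT0.eq_or_lt with hT00 | hTpos
      · rw [← hT00, mul_zero, mul_zero, mul_zero]
        positivity
      · have hq : 1 ≤ (P.L : ℝ) ^ k / T12 := by rw [le_div_iff₀ hTpos, one_mul]; exact hnear
        have hw1 : w ≤ (P.L : ℝ) ^ k / T12 := rpow_le_self_of_one_le hq hθ1
        calc w * (P.eps * B₁ * (((d : ℝ) + 1) * T12)) ≤ (P.L : ℝ) ^ k / T12 * (P.eps * B₁ * (((d : ℝ) + 1) * T12)) :=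
              mul_le_mul_of_nonneg_right hw1 (by positivity)
          _ = ((d : ℝ) + 1) * (P.eps * (P.L : ℝ) ^ k) * B₁ := by
              rw [div_mul_eq_mul_div, div_eq_iff hTpos.ne']
              ring
    have hspacing : P.eps * (P.L : ℝ) ^ k = P.spacing k := by rw [Params.spacing]; ring
    calc w * ‖(toC (h x₂))⁻¹ * ψ x₂ - (toC (h x₁))⁻¹ * ψ x₁‖ ≤ w * (P.eps * B₁ * (((d : ℝ) + 1) * T12)) :=
          mul_le_mul_of_nonneg_left hdiff hw0
      _ ≤ ((d : ℝ) + 1) * (P.eps * (P.L : ℝ) ^ k) * B₁ := hwT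
      _ ≤ ((d : ℝ) + 1) * P.spacing k * (P.spacing k * (Real.exp (δ₁ / 2) * c₁ * Br * Ex * F)) := by
          rw [hspacing]; exact mul_le_mul_of_nonneg_left hB₁le (by positivity)
      _ = P.spacing k ^ 2 * ((((d : ℝ) + 1) * Real.exp (δ₁ / 2) * c₁) * Br * Ex * F) := by ring
      _ ≤ P.spacing k ^ 2 * (C * Br * Ex * F) := by
          refine mul_le_mul_of_nonneg_left ?_ (sq_nonneg _)
          exact mul_le_mul_of_nonneg_right (mul_le_mul_of_nonneg_right (mul_le_mul_of_nonneg_right hC1 hBr0) hE0.le) hF0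
  · /- FAR PAIRS: two (2.31) value members -/
    push Not at hnear
    have hTpos : 0 < T12 := hLk.trans hnear
    have hw1 : w ≤ 1 := by
      refine Real.rpow_le_one (div_nonneg hLk.le hT0) ?_ hθ0
      rw [div_le_one hTpos]; exact hnear.le
    have hv₁ := H2 P hPd hPL k hk1 hkK c M0 hM0 hfit0 hN0 s W hs R R₀ R₁ hR0 hR₁ hR10 hW hgapR h x₁ hx₁ hdeep₁ f F D hF hD hsupp₁
    have hv₂ := H2 P hPd hPL k hk1 hkK c M0 hM0 hfit0 hN0 s W hs R R₀ R₁ hR0 hR₁ hR10 hW hgapR h x₂ hx₂ hdeep₂ f F D hF hD hsupp₂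
    have hn₁ : ‖(toC (h x₁))⁻¹ * ψ x₁‖ = ‖ψ x₁‖ := by rw [norm_mul, norm_inv, norm_toC, inv_one, one_mul]
    have hn₂ : ‖(toC (h x₂))⁻¹ * ψ x₂‖ = ‖ψ x₂‖ := by rw [norm_mul, norm_inv, norm_toC, inv_one, one_mul]
    have hval : ∀ x : Balaban1983to89.Site P 0,
        ‖ψL x - ψΩ x‖ ≤ P.spacing k ^ 2 * (c₂ * (((⌊(((P.L : ℝ) ^ k) - 1 + R₀) / s⌋₊ : ℝ) + 3) ^ (d + 1) *
            Real.exp (-(δ₂ * (((P.L : ℝ) ^ k)⁻¹ * (2 * R)))) + Real.exp (-(δ₂ / 2 * (((P.L : ℝ) ^ k)⁻¹ * R₁)))) *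
          Real.exp (-(δ₂ / 2 * (((P.L : ℝ) ^ k)⁻¹ * D))) * F) → ‖ψ x‖ ≤ P.spacing k ^ 2 * (c₂ * Br * Ex * F) := by
      intro x hx
      rw [← hψ]
      refine hx.trans (mul_le_mul_of_nonneg_left ?_ (sq_nonneg _))
      rw [← hmdef]
      have hbr_le : m * Real.exp (-(δ₂ * (((P.L : ℝ) ^ k)⁻¹ * (2 * R)))) + Real.exp (-(δ₂ / 2 * (((P.L : ℝ) ^ k)⁻¹ * R₁))) ≤ Br := by
        rw [hBrdef]
        refine add_le_add ?_ ?_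
        · calc m * Real.exp (-(δ₂ * (((P.L : ℝ) ^ k)⁻¹ * (2 * R)))) ≤ m * ER := mul_le_mul_of_nonneg_left hER_2 hm0
            _ = m * 1 * ER := by ring
            _ ≤ m * br * ER := mul_le_mul_of_nonneg_right (mul_le_mul_of_nonneg_left hbr1 hm0) hER0.le
        · calc Real.exp (-(δ₂ / 2 * (((P.L : ℝ) ^ k)⁻¹ * R₁))) ≤ ER₁ := hER₁_2
            _ = 1 * ER₁ := (one_mul _).symm
            _ ≤ br₁ * ER₁ := mul_le_mul_of_nonneg_right hbr₁1 hER₁0.le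
      calc c₂ * (m * Real.exp (-(δ₂ * (((P.L : ℝ) ^ k)⁻¹ * (2 * R)))) + Real.exp (-(δ₂ / 2 * (((P.L : ℝ) ^ k)⁻¹ * R₁)))) *
            Real.exp (-(δ₂ / 2 * (((P.L : ℝ) ^ k)⁻¹ * D))) * F ≤ c₂ * Br * Ex * F :=
          mul_le_mul_of_nonneg_right (mul_le_mul (mul_le_mul_of_nonneg_left hbr_le hc₂.le) hE2 (Real.exp_pos _).le (by positivity)) hF0
        _ = c₂ * Br * Ex * F := rfl
    have h1 := hval x₁ hv₁
    have h2 := hval x₂ hv₂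
    have hsub : ‖(toC (h x₂))⁻¹ * ψ x₂ - (toC (h x₁))⁻¹ * ψ x₁‖ ≤
        P.spacing k ^ 2 * (c₂ * Br * Ex * F) + P.spacing k ^ 2 * (c₂ * Br * Ex * F) := by
      refine (norm_sub_le _ _).trans ?_
      rw [hn₁, hn₂]
      exact add_le_add h2 h1
    calc w * ‖(toC (h x₂))⁻¹ * ψ x₂ - (toC (h x₁))⁻¹ * ψ x₁‖ ≤ ‖(toC (h x₂))⁻¹ * ψ x₂ - (toC (h x₁))⁻¹ * ψ x₁‖ :=
          mul_le_of_le_one_left (norm_nonneg _) hw1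
      _ ≤ P.spacing k ^ 2 * (c₂ * Br * Ex * F) + P.spacing k ^ 2 * (c₂ * Br * Ex * F) := hsub
      _ = P.spacing k ^ 2 * ((2 * c₂) * Br * Ex * F) := by ring
      _ ≤ P.spacing k ^ 2 * (C * Br * Ex * F) := by
          refine mul_le_mul_of_nonneg_left ?_ (sq_nonneg _)
          exact mul_le_mul_of_nonneg_right (mul_le_mul_of_nonneg_right (mul_le_mul_of_nonneg_right hC2 hBr0) hE0.le) hF0

end Holder

end

end Literature.MathematicalPhysics.QuantumFieldTheory.BalabanImbrieJaffe1984to88.BIJ88LocHolder231FlatTorus
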